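import Summits.QuantumAdvantage.QuantumAdvantage.Theorems.RankDialK1
import HarnessLib

/-!
# RankDial (K2) — §27 the PERTURB LAW `WindowJSpanLinSel` (PROVED `p ≠ 3`) ⊇ span law, the residual `WindowJSpreadLinSel`, `highRank_iff_jspread`, `perturb_dial`

TARGET BY NAME (cell decomp-qadv, RESIDUAL MODE): item stmt-QuantumAdvantage-23109
`Summit.QuantumAdvantage.QuantumAdvantage.Theses.OddPrimeWalk.ManyReadersSqrtOdd`, through rung R5 = `AdviceFreeQNC0.WalkHardFLinSel p`.
This file SUPPORTS the item (`--supports`); it does not close it.  Declaration bodies are byte-identical to the cell node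
«PerturbDial» (decomp-qadv lens-1, generation 26, part K; node file RankDialK.lean = node «BiasDial» RankDialJ.lean (parts G, H, I, J =
tree files RankDialG1–G2, H1–H3, I1–I3, J1) followed by §26–§27), cut into ≤ 400-line parts
K1 (§26 the junta-rank grade `JRankLE`, the perturbed-span grade `PRankLE`, the class-sum bound and the fibre/window theorems; imports I3 —
it does not use part J) → K2 (§27 pieces: `WindowJSpanLinSel` PROVED `p ≠ 3` ⊇ span law, residual `WindowJSpreadLinSel`, `perturb_dial`).
See the node file for the mechanism summary.
-/

set_option linter.dupNamespace false
set_option autoImplicit false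

noncomputable section
open Classical

namespace Summit.QuantumAdvantage.QuantumAdvantage.Theorems.RankDial

open Finset
open Summit.QuantumAdvantage.AdviceFreeQNC0
open Literature.Computability.MetaComplexity Literature.Computability.MetaComplexity.Smolensky

/-! ### §27 The pieces: the PERTURB LAW `WindowJSpanLinSel` (PROVED `p ≠ 3`) ⊇ span law, and the residual `WindowJSpreadLinSel` -/

section PerturbPieces
variable (p : ℕ) [Fact p.Prime]

/-- **PIECE `WindowJSpanLinSel p`** (the junta-rank grade, linear tests): for every width `s` there are `θ < 1` and a
budget unit `M` such that a linear-test strategy with a cut-free window of length `ℓ`, ANY number of cuts of window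
support `≤ s`, and wide cuts answering on every fibre through `D` linear forms of the window plus `≤ s` own window bits,
with `(p·D + 2)·M ≤ ℓ`, wins on `≤ θ·2ⁿ` inputs.  [NECESSARY · contains the span piece (`windowSpan_of_jspan`) hence the
mixed, junta and few-readers pieces · covers perturbed spans (`jRankLE_of_pRankLE`) incl. the hard instance of parts H/I
(`pRankLE_one_of_near_colinear`) · **PROVED for every prime `p ≠ 3`**: `windowJSpanLinSel_holds` (`θ = 11/12`).] -/
def WindowJSpanLinSel : Prop :=
  ∀ s : ℕ, ∃ θ : ℝ, θ < 1 ∧ ∃ M : ℕ, ∀ L ℓ R : ℕ,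
    ∀ (c : ℕ) (y : Fin (L + ℓ + R + 1) → (Fin (L + ℓ + R) → Bool) → Bool)
      (lam : Fin (L + ℓ + R + 1) → Fin (L + ℓ + R) → ZMod p) (rr : Fin (L + ℓ + R + 1) → ZMod p),
      (∀ g u, y g u = decide ((∑ i, if u i then lam g i else 0) = rr g)) → CutFree y L ℓ →
      ∀ D : ℕ, JRankLE p y lam s D → (p * D + 2) * M ≤ ℓ →
      ((univ.filter fun u : Fin (L + ℓ + R) → Bool => ringWinU c y u = true).card : ℝ) ≤ θ * (2 : ℝ) ^ (L + ℓ + R)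

/-- **THE PERTURB LAW IS A THEOREM** for every prime `p ≠ 3` (`θ = 11/12`). -/
theorem windowJSpanLinSel_holds (hp3 : p ≠ 3) : WindowJSpanLinSel p := by
  intro s
  obtain ⟨M, hM⟩ : ∃ M : ℕ, 2 * 4 ^ (s + 1) ≤ (M : ℝ) * etaP p := by
    obtain ⟨M, hM⟩ := exists_nat_ge (2 * 4 ^ (s + 1) / etaP p)
    exact ⟨M, by rwa [div_le_iff₀ (etaP_pos (p := p))] at hM⟩
  refine ⟨11 / 12, by norm_num, M, fun L ℓ R c y lam rr hyl hgap D hJR hℓ => ?_⟩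
  have h := window_bound_jrank hp3 L ℓ R c y lam rr hyl hgap hM hJR hℓ
  have h' : (12 : ℝ) * ((univ.filter fun u : Fin (L + ℓ + R) → Bool => ringWinU c y u = true).card : ℝ) ≤
      11 * (2 : ℝ) ^ (L + ℓ + R) := by exact_mod_cast h
  linarith

/-- NECESSARY: R5 implies the perturb piece. -/
theorem windowJSpan_of_r5 (h : WalkHardFLinSel p) : WindowJSpanLinSel p := by
  intro s
  obtain ⟨θ, hθ, n₀, h⟩ := h
  refine ⟨θ, hθ, n₀, fun L ℓ R c y lam rr hyl _ D _ hℓ => ?_⟩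
  have h2 : 2 * n₀ ≤ (p * D + 2) * n₀ := Nat.mul_le_mul_right _ (by omega)
  have hn : n₀ ≤ L + ℓ + R := by omega
  exact h (L + ℓ + R) hn c y fun g => ⟨lam g, rr g, hyl g⟩

/-- **The perturb law contains the span law** (wide rank `D` ⟹ junta rank `D`, same budget). -/
theorem windowSpan_of_jspan (h : WindowJSpanLinSel p) : WindowSpanLinSel p := by
  intro s
  obtain ⟨θ, hθ, M, h⟩ := h s
  exact ⟨θ, hθ, M, fun L ℓ R c y lam rr hyl hgap D hWR hℓ =>
    h L ℓ R c y lam rr hyl hgap D (jRankLE_of_wRankLE y lam hWR) hℓ⟩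

/-- **PIECE `WindowJSpreadLinSel p s`** (the residual after part K): the window law for windows whose wide cuts do
NOT answer through `ℓ/E` linear forms plus `≤ s` own bits on some fibre (`¬ JRankLE p y lam s (ℓ/E)`; this implies
`¬ WRankLE`, `¬ RankLE`, more than `ℓ/E` wide cuts, and that the wide window forms stay of rank `> ℓ/E` after
discarding any `s` coordinates per cut).  [NECESSARY · implied by the spread piece (`jspread_of_spread`) ·
`WindowHighRankLinSel p ↔ WindowJSpreadLinSel p s` (`highRank_iff_jspread`, `p ≠ 3`) · IDEA-NEEDED.] -/
def WindowJSpreadLinSel (s : ℕ) : Prop :=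
  ∀ E : ℕ, 0 < E → ∃ θ : ℝ, θ < 1 ∧ ∃ C : ℕ, ∃ n₀ : ℕ, ∀ L ℓ R : ℕ, n₀ ≤ L + ℓ + R →
    C * (Nat.log 2 (L + ℓ + R) + 1) ≤ ℓ →
    ∀ (c : ℕ) (y : Fin (L + ℓ + R + 1) → (Fin (L + ℓ + R) → Bool) → Bool)
      (lam : Fin (L + ℓ + R + 1) → Fin (L + ℓ + R) → ZMod p) (rr : Fin (L + ℓ + R + 1) → ZMod p),
      (∀ g u, y g u = decide ((∑ i, if u i then lam g i else 0) = rr g)) → CutFree y L ℓ →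
      ¬ JRankLE p y lam s (ℓ / E) →
      ((univ.filter fun u : Fin (L + ℓ + R) → Bool => ringWinU c y u = true).card : ℝ) ≤ θ * (2 : ℝ) ^ (L + ℓ + R)

/-- **The residual shrank**: the spread piece implies the junta-spread piece. -/
theorem jspread_of_spread (s : ℕ) (h : WindowSpreadLinSel p s) : WindowJSpreadLinSel p s := by
  intro E hE
  obtain ⟨θ, hθ, C, n₀, h⟩ := h E hE
  exact ⟨θ, hθ, C, n₀, fun L ℓ R hn hC c y lam rr hyl hgap hJ =>
    h L ℓ R hn hC c y lam rr hyl hgap fun hW => hJ (jRankLE_of_wRankLE y lam hW)⟩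

/-- NECESSARY: the high-rank piece implies the junta-spread piece. -/
theorem jspread_of_highRank (s : ℕ) (h : WindowHighRankLinSel p) : WindowJSpreadLinSel p s :=
  jspread_of_spread p s (spread_of_highRank p s h)

/-- **The perturb law shrinks the residual**: perturb law ∧ junta-spread piece ⟹ high-rank piece. -/
theorem highRank_of_jspan_jspread (s : ℕ) (hSp : WindowJSpanLinSel p) (hSd : WindowJSpreadLinSel p s) :
    WindowHighRankLinSel p := by
  intro E hE
  have hp1 : 1 ≤ p := (Fact.out : p.Prime).one_lt.le
  obtain ⟨θ₁, hθ₁, M, hSp⟩ := hSp s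
  set E' := max E (3 * (p * (M + 1))) with hE'
  have hE'pos : 0 < E' := lt_of_lt_of_le hE (le_max_left _ _)
  obtain ⟨θ₂, hθ₂, C₂, n₂, hSd⟩ := hSd E' hE'pos
  refine ⟨max θ₁ θ₂, max_lt hθ₁ hθ₂, max C₂ (3 * (M + 1)), n₂, fun L ℓ R hn hCle c y hy hgap _ => ?_⟩
  have hlog : 1 ≤ Nat.log 2 (L + ℓ + R) + 1 := Nat.le_add_left 1 _
  have hC₂ : C₂ * (Nat.log 2 (L + ℓ + R) + 1) ≤ ℓ :=
    le_trans (Nat.mul_le_mul_right _ (le_max_left C₂ _)) hCle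
  have h3M : 3 * (M + 1) ≤ ℓ :=
    le_trans (le_trans (le_max_right C₂ _) (Nat.le_mul_of_pos_right _ hlog)) hCle
  have hpos : (0 : ℝ) ≤ (2 : ℝ) ^ (L + ℓ + R) := by positivity
  choose lam rr hyl using hy
  by_cases hJ : JRankLE p y lam s (ℓ / E')
  · -- low junta rank: the perturb law
    set q := ℓ / (3 * (p * (M + 1))) with hq
    have hqE : ℓ / E' ≤ q := Nat.div_le_div_left (le_max_right _ _) (by positivity)
    have hqmul : q * (3 * (p * (M + 1))) ≤ ℓ := Nat.div_mul_le_self ℓ _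
    have hA : 3 * (p * q * M) ≤ ℓ := by
      have h1 : 3 * (p * q * M) ≤ q * (3 * (p * (M + 1))) := by nlinarith
      omega
    have hbudget : (p * (ℓ / E') + 2) * M ≤ ℓ := by
      have h1 : (p * (ℓ / E') + 2) * M ≤ (p * q + 2) * M :=
        Nat.mul_le_mul_right _ (by nlinarith)
      have h2 : (p * q + 2) * M = p * q * M + 2 * M := by ring
      omega
    exact le_trans (hSp L ℓ R c y lam rr hyl hgap _ hJ hbudget)
      (mul_le_mul_of_nonneg_right (le_max_left θ₁ θ₂) hpos)
  · exact le_trans (hSd L ℓ R hn hC₂ c y lam rr hyl hgap hJ) (mul_le_mul_of_nonneg_right (le_max_right θ₁ θ₂) hpos)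

/-- With the perturb law a theorem, the junta-spread piece IS the high-rank piece (every `s`, `p ≠ 3`). -/
theorem highRank_iff_jspread (hp3 : p ≠ 3) (s : ℕ) : WindowHighRankLinSel p ↔ WindowJSpreadLinSel p s :=
  ⟨jspread_of_highRank p s, highRank_of_jspan_jspread p s (windowJSpanLinSel_holds p hp3)⟩

/-- **RESIDUAL OF R5 AFTER PART K** (`p ≥ 5`, any width `s`): `WindowJSpreadLinSel p s ∧ NoWindowLinSel p ⟹
WalkHardFLinSel p`. -/
theorem r5_residual_jspread (hp : 5 ≤ p) (s : ℕ) (hSd : WindowJSpreadLinSel p s) (hN : NoWindowLinSel p) :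
    WalkHardFLinSel p :=
  r5_residual hp (highRank_of_jspan_jspread p s (windowJSpanLinSel_holds p (by omega)) hSd) hN

/-- The hard instance of parts H/I is now INSIDE the proved law: near-colinear wide forms (`t_g·β` up to `≤ s`
coordinates) have junta rank one, so the perturb law bounds such windows as soon as `(p + 2)·M ≤ ℓ`. -/
theorem jRankLE_one_of_near_colinear {L ℓ R : ℕ} (y : Fin (L + ℓ + R + 1) → (Fin (L + ℓ + R) → Bool) → Bool)
    (lam : Fin (L + ℓ + R + 1) → Fin (L + ℓ + R) → ZMod p) (rr : Fin (L + ℓ + R + 1) → ZMod p)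
    (hyl : ∀ g u, y g u = decide ((∑ i, if u i then lam g i else 0) = rr g)) (s : ℕ) (β : Fin ℓ → ZMod p)
    (h : ∀ g : Fin (L + ℓ + R + 1), s < (wsupp lam g).card → ∃ t : ZMod p,
      (univ.filter fun j : Fin ℓ => lamW lam g j ≠ t * β j).card ≤ s) :
    JRankLE p y lam s 1 :=
  jRankLE_of_pRankLE y lam rr hyl (pRankLE_one_of_near_colinear lam s β h)

/-- **THE PERTURB DIAL** (`p ≥ 5`): the perturb law holds and contains the span law; the junta-spread piece is the
high-rank piece and is implied by the spread piece; junta-spread ∧ no-window ⟹ R5. -/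
theorem perturb_dial (hp : 5 ≤ p) :
    WindowJSpanLinSel p ∧ (WindowJSpanLinSel p → WindowSpanLinSel p) ∧
      (∀ s, (WindowHighRankLinSel p ↔ WindowJSpreadLinSel p s)) ∧
      (∀ s, WindowSpreadLinSel p s → WindowJSpreadLinSel p s) ∧
      (∀ s, WindowJSpreadLinSel p s → NoWindowLinSel p → WalkHardFLinSel p) :=
  ⟨windowJSpanLinSel_holds p (by omega), windowSpan_of_jspan p, highRank_iff_jspread p (by omega),
    jspread_of_spread p, r5_residual_jspread p hp⟩

end PerturbPieces

end Summit.QuantumAdvantage.QuantumAdvantage.Theorems.RankDial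

end
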